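import Literature.MathematicalPhysics.QuantumFieldTheory.ConformalBootstrap3D.HRCoeffBoundTables
import Literature.MathematicalPhysics.QuantumFieldTheory.ConformalBootstrap3D.MixedBlockCoefficients

/-!
# Tables for `(Δ-ℓ-1)·A_{n,j}(c,c;Δ,ℓ)` down to the unitarity bound

The unequal-dimension Hogervorst–Rychkov array with `a = b = c` (the `σ–ε` system's `gpm` array,
`c = (Δ_σ-Δ_ε)/2`) factorises (Dolan–Osborn 2004, eq. (3.11); tree:
`hrCoeffAB_eq_doPochFactor_div_mul`) as `A_{n,j}(c,c) = Π_{cc}/Π_{00} · A_{n,j}(0,0)` with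
`Π_{cc}/Π_{00} = ∏_{i<m} ((X+i+c)/(X+i))² · ∏_{i<n'} ((x+i+c)/(x+i))²`, `X = (Δ+ℓ)/2`,
`x = (Δ-ℓ-1)/2`, `m = doIndexM`, `n' = doIndexN` (`doPochFactor_self_div`). For `ℓ ≥ 1` the
`i = 0` factor of the second product is the simple POLE at the unitarity bound; multiplying by
`Δ - ℓ - 1 = 2x` and using the pole-normalised array `Ã = A(0,0)/(Δ-ℓ-1)` (`HRCoeffBoundTables`)
gives the finite closed form
`(Δ-ℓ-1)·A_{n,j}(c,c) = 4(x+c)² · ∏_{i<m}(…)² · ∏_{1≤i<n'}(…)² · Ã_{n,j}` below the leading twist line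
and `= (Δ-ℓ-1) · ∏_{i<m}(…)² · Ã_{n,j}` on it (`sub_mul_hrCoeffAB_self_eq`). Every factor is enclosed
on `Δ ∈ [a,b]`, `c ∈ [c₁,c₂]` by corner values (`ratioSq_sandwich`, `ratioSqProd_sandwich`,
`sqLower/sqUpper`), whence the TABLES `hrCoeffABBdLo/Hi c₁ c₂ a b ℓ n j` with
`0 ≤ Lo ≤ (Δ-ℓ-1)·A_{n,j}(c,c;Δ,ℓ) ≤ Hi` for `ℓ ≥ 1`, `ℓ+1 ≤ a ≤ Δ ≤ b`, `Δ > ℓ+1`, `c ∈ [c₁,c₂]`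
(`sub_mul_hrCoeffAB_self_sandwich`) — the coefficient data of odd-sector light-block cells that start
AT the bound. [cite: DolanOsborn2004, §3 eq. (3.11)] [cite: HogervorstRychkov2013, §3 eq. (3.9)]
-/

noncomputable section

namespace Literature.MathematicalPhysics.QuantumFieldTheory.ConformalBootstrap3D

open Finset Set

/-! ### Enclosure of one ratio factor `((y+c)/y)²` -/

/-- `c/y ∈ [min(c₁/y_lo, c₁/y_hi), max(c₂/y_lo, c₂/y_hi)]` for `0 < y_lo ≤ y ≤ y_hi`, `c ∈ [c₁,c₂]`.
[folklore] -/
theorem div_mem_corners {ylo y yhi c₁ c c₂ : ℝ} (hylo : 0 < ylo) (h1 : ylo ≤ y) (h2 : y ≤ yhi)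
    (hc1 : c₁ ≤ c) (hc2 : c ≤ c₂) :
    min (c₁ / ylo) (c₁ / yhi) ≤ c / y ∧ c / y ≤ max (c₂ / ylo) (c₂ / yhi) := by
  have hy : 0 < y := hylo.trans_le h1
  have hyhi : 0 < yhi := hy.trans_le h2
  constructor
  · have hcy : c₁ / y ≤ c / y := div_le_div_of_nonneg_right hc1 hy.le
    refine le_trans ?_ hcy
    rcases le_or_gt 0 c₁ with hc | hc
    · exact (min_le_right _ _).trans (div_le_div_of_nonneg_left hc hy h2)
    · refine (min_le_left _ _).trans ?_
      have h := div_le_div_of_nonneg_left (neg_nonneg.mpr hc.le) hylo h1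
      rw [neg_div, neg_div] at h
      linarith
  · have hcy : c / y ≤ c₂ / y := div_le_div_of_nonneg_right hc2 hy.le
    refine hcy.trans ?_
    rcases le_or_gt 0 c₂ with hc | hc
    · exact (div_le_div_of_nonneg_left hc hylo h1).trans (le_max_left _ _)
    · refine le_trans ?_ (le_max_right _ _)
      have h := div_le_div_of_nonneg_left (neg_nonneg.mpr hc.le) hy h2
      rw [neg_div, neg_div] at h
      linarith

/-- Lower corner enclosure of `((y+c)/y)²` over `y ∈ [y_lo, y_hi] ⊂ (0,∞)`, `c ∈ [c₁, c₂]`. [folklore] -/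
def ratioSqLo (ylo yhi c₁ c₂ : ℝ) : ℝ :=
  sqLower (1 + min (c₁ / ylo) (c₁ / yhi)) (1 + max (c₂ / ylo) (c₂ / yhi))

/-- Upper corner enclosure of `((y+c)/y)²`. [folklore] -/
def ratioSqHi (ylo yhi c₁ c₂ : ℝ) : ℝ :=
  sqUpper (1 + min (c₁ / ylo) (c₁ / yhi)) (1 + max (c₂ / ylo) (c₂ / yhi))

/-- `0 ≤ ratioSqLo ≤ ((y+c)/y)² ≤ ratioSqHi`. [folklore] -/
theorem ratioSq_sandwich {ylo y yhi c₁ c c₂ : ℝ} (hylo : 0 < ylo) (h1 : ylo ≤ y) (h2 : y ≤ yhi)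
    (hc1 : c₁ ≤ c) (hc2 : c ≤ c₂) :
    0 ≤ ratioSqLo ylo yhi c₁ c₂ ∧ ratioSqLo ylo yhi c₁ c₂ ≤ ((y + c) / y) ^ 2 ∧
      ((y + c) / y) ^ 2 ≤ ratioSqHi ylo yhi c₁ c₂ := by
  have hy : 0 < y := hylo.trans_le h1
  have hg : (y + c) / y = 1 + c / y := by rw [add_div, div_self hy.ne']
  obtain ⟨hlo, hhi⟩ := div_mem_corners hylo h1 h2 hc1 hc2
  rw [hg]
  exact ⟨sqLower_nonneg _ _, sqLower_le_sq (by linarith) (by linarith),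
    sq_le_sqUpper (by linarith) (by linarith)⟩

/-! ### Products of ratio factors -/

/-- `∏_{i<K} ((y₀+i+c)/(y₀+i))²`. [cite: DolanOsborn2004, §3 eq. (3.11)] -/
def ratioSqProd (y₀ c : ℝ) (K : ℕ) : ℝ := ∏ i ∈ range K, ((y₀ + i + c) / (y₀ + i)) ^ 2

/-- Lower table of `ratioSqProd y₀ c K` for `y₀ ∈ [y_lo, y_hi]`, `c ∈ [c₁, c₂]`. [folklore] -/
def ratioSqProdLo (ylo yhi c₁ c₂ : ℝ) (K : ℕ) : ℝ :=
  ∏ i ∈ range K, ratioSqLo (ylo + i) (yhi + i) c₁ c₂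

/-- Upper table of `ratioSqProd y₀ c K`. [folklore] -/
def ratioSqProdHi (ylo yhi c₁ c₂ : ℝ) (K : ℕ) : ℝ :=
  ∏ i ∈ range K, ratioSqHi (ylo + i) (yhi + i) c₁ c₂

/-- `0 ≤ Lo ≤ ratioSqProd y₀ c K ≤ Hi` for `0 < y_lo ≤ y₀ ≤ y_hi`, `c ∈ [c₁, c₂]`. [folklore] -/
theorem ratioSqProd_sandwich {ylo y₀ yhi c₁ c c₂ : ℝ} (hylo : 0 < ylo) (h1 : ylo ≤ y₀) (h2 : y₀ ≤ yhi)
    (hc1 : c₁ ≤ c) (hc2 : c ≤ c₂) :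
    ∀ K : ℕ, 0 ≤ ratioSqProdLo ylo yhi c₁ c₂ K ∧ ratioSqProdLo ylo yhi c₁ c₂ K ≤ ratioSqProd y₀ c K ∧
      ratioSqProd y₀ c K ≤ ratioSqProdHi ylo yhi c₁ c₂ K
  | 0 => by simp [ratioSqProd, ratioSqProdLo, ratioSqProdHi]
  | K + 1 => by
      obtain ⟨h0, hl, hh⟩ := ratioSqProd_sandwich hylo h1 h2 hc1 hc2 K
      have hf := ratioSq_sandwich (ylo := ylo + K) (y := y₀ + K) (yhi := yhi + K) (by positivity)
        (by linarith) (by linarith) hc1 hc2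
      obtain ⟨hf0, hfl, hfh⟩ := hf
      simp only [ratioSqProd, ratioSqProdLo, ratioSqProdHi, Finset.prod_range_succ] at *
      exact mul_sandwich h0 hl hh hf0 hfl hfh

/-- Splitting off the first factor: `∏_{i<K+1} r(y₀+i) = r(y₀) · ∏_{i<K} r(y₀+1+i)`. [folklore] -/
theorem ratioSqProd_succ_left (y₀ c : ℝ) (K : ℕ) :
    ratioSqProd y₀ c (K + 1) = ((y₀ + c) / y₀) ^ 2 * ratioSqProd (y₀ + 1) c K := by
  unfold ratioSqProd
  rw [Finset.prod_range_succ', mul_comm]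
  congr 1
  · simp
  · apply Finset.prod_congr rfl
    intro i _
    push_cast
    ring_nf

/-! ### The Dolan–Osborn ratio in product form -/

/-- `Π_{cc}/Π_{00} = ∏_{i<m} ((X+i+c)/(X+i))² · ∏_{i<n'} ((x+i+c)/(x+i))²` (unconditionally, with
Lean's `x/0 = 0` on both sides). [cite: DolanOsborn2004, §3 eq. (3.11)] -/
theorem doPochFactor_self_div (c Δ : ℝ) (ℓ n j : ℕ) :
    doPochFactor c c Δ ℓ n j / doPochFactor 0 0 Δ ℓ n j =
      ratioSqProd ((Δ + ℓ) / 2) c (doIndexM ℓ n j) * ratioSqProd ((Δ - ℓ - 1) / 2) c (doIndexN ℓ n j) := by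
  unfold doPochFactor ratioSqProd
  rw [mul_div_mul_comm, ← Finset.prod_div_distrib, ← Finset.prod_div_distrib]
  congr 1 <;> (apply Finset.prod_congr rfl; intro i _; rw [add_zero, div_pow, sq, sq])

/-- `n' ≥ 1` exactly below the leading twist line. [folklore] -/
theorem doIndexN_pos_iff (ℓ n j : ℕ) : 0 < doIndexN ℓ n j ↔ j + 2 ≤ ℓ + n := by
  unfold doIndexN; omega

/-! ### The closed form of `(Δ-ℓ-1)·A(c,c)` -/

/-- **Below the leading line** (`j + 2 ≤ ℓ + n`, `Δ > ℓ + 1`):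
`(Δ-ℓ-1)·A_{n,j}(c,c) = 4(x+c)² · ∏_{i<m}((X+i+c)/(X+i))² · ∏_{i<n'-1}((x+1+i+c)/(x+1+i))² · Ã_{n,j}`.
[cite: DolanOsborn2004, §3 eq. (3.11)] -/
theorem sub_mul_hrCoeffAB_self_eq_of_le {c Δ : ℝ} {ℓ n j : ℕ} (hx : (ℓ : ℝ) + 1 < Δ)
    (h : j + 2 ≤ ℓ + n) :
    (Δ - ℓ - 1) * hrCoeffAB c c Δ ℓ n j =
      4 * ((Δ - ℓ - 1) / 2 + c) ^ 2 * ratioSqProd ((Δ + ℓ) / 2) c (doIndexM ℓ n j) *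
        ratioSqProd ((Δ - ℓ - 1) / 2 + 1) c (doIndexN ℓ n j - 1) * hrCoeffBd Δ ℓ n j := by
  have hℓ0 : (0 : ℝ) ≤ ℓ := Nat.cast_nonneg ℓ
  have hbd : unitarityBound3D ℓ < Δ := lt_of_le_of_lt (unitarityBound3D_le_add_one ℓ) hx
  have hP : doPochFactor 0 0 Δ ℓ n j ≠ 0 :=
    (doPochFactor_zero_zero_pos hbd (fun _ => by intro h1; linarith) n j).ne'
  have hx0 : Δ - ℓ - 1 ≠ 0 := by intro h0; linarith
  have hx2 : (Δ - ℓ - 1) / 2 ≠ 0 := by intro h0; apply hx0; linarith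
  obtain ⟨k, hk⟩ : ∃ k, doIndexN ℓ n j = k + 1 :=
    ⟨doIndexN ℓ n j - 1, by have := (doIndexN_pos_iff ℓ n j).mpr h; omega⟩
  rw [hrCoeffAB_eq_doPochFactor_div_mul hP, doPochFactor_self_div, hk, ratioSqProd_succ_left,
    hrCoeff_eq_hrCoeffBd_mul hx0 h, show k + 1 - 1 = k by omega]
  field_simp
  ring

/-- **On the leading line** (`¬ j + 2 ≤ ℓ + n`):
`(Δ-ℓ-1)·A_{n,j}(c,c) = (Δ-ℓ-1) · ∏_{i<m}((X+i+c)/(X+i))² · Ã_{n,j}`.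
[cite: DolanOsborn2004, §3 eq. (3.11)] -/
theorem sub_mul_hrCoeffAB_self_eq_of_not_le {c Δ : ℝ} {ℓ n j : ℕ} (hx : (ℓ : ℝ) + 1 < Δ)
    (h : ¬ j + 2 ≤ ℓ + n) :
    (Δ - ℓ - 1) * hrCoeffAB c c Δ ℓ n j =
      (Δ - ℓ - 1) * ratioSqProd ((Δ + ℓ) / 2) c (doIndexM ℓ n j) * hrCoeffBd Δ ℓ n j := by
  have hℓ0 : (0 : ℝ) ≤ ℓ := Nat.cast_nonneg ℓ
  have hbd : unitarityBound3D ℓ < Δ := lt_of_le_of_lt (unitarityBound3D_le_add_one ℓ) hx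
  have hP : doPochFactor 0 0 Δ ℓ n j ≠ 0 :=
    (doPochFactor_zero_zero_pos hbd (fun _ => by intro h1; linarith) n j).ne'
  have hN : doIndexN ℓ n j = 0 := by
    have := doIndexN_pos_iff ℓ n j; omega
  rw [hrCoeffAB_eq_doPochFactor_div_mul hP, doPochFactor_self_div, hN, hrCoeffBd_of_not_le h]
  simp [ratioSqProd]
  ring

/-! ### The tables -/

/-- **Lower table** of `(Δ-ℓ-1)·A_{n,j}(c,c;Δ,ℓ)` for `Δ ∈ [a,b]` (`a ≥ ℓ+1`), `c ∈ [c₁,c₂]`.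
[cite: DolanOsborn2004, §3 eq. (3.11)] -/
def hrCoeffABBdLo (c₁ c₂ a b : ℝ) (ℓ n j : ℕ) : ℝ :=
  if j + 2 ≤ ℓ + n then
    4 * sqLower ((a - ℓ - 1) / 2 + c₁) ((b - ℓ - 1) / 2 + c₂) *
      ratioSqProdLo ((a + ℓ) / 2) ((b + ℓ) / 2) c₁ c₂ (doIndexM ℓ n j) *
      ratioSqProdLo ((a - ℓ - 1) / 2 + 1) ((b - ℓ - 1) / 2 + 1) c₁ c₂ (doIndexN ℓ n j - 1) *
      hrCoeffBdLo a b ℓ n j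
  else (a - ℓ - 1) * ratioSqProdLo ((a + ℓ) / 2) ((b + ℓ) / 2) c₁ c₂ (doIndexM ℓ n j) *
      hrCoeffBdLo a b ℓ n j

/-- **Upper table** of `(Δ-ℓ-1)·A_{n,j}(c,c;Δ,ℓ)` for `Δ ∈ [a,b]` (`a ≥ ℓ+1`), `c ∈ [c₁,c₂]`.
[cite: DolanOsborn2004, §3 eq. (3.11)] -/
def hrCoeffABBdHi (c₁ c₂ a b : ℝ) (ℓ n j : ℕ) : ℝ :=
  if j + 2 ≤ ℓ + n then
    4 * sqUpper ((a - ℓ - 1) / 2 + c₁) ((b - ℓ - 1) / 2 + c₂) *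
      ratioSqProdHi ((a + ℓ) / 2) ((b + ℓ) / 2) c₁ c₂ (doIndexM ℓ n j) *
      ratioSqProdHi ((a - ℓ - 1) / 2 + 1) ((b - ℓ - 1) / 2 + 1) c₁ c₂ (doIndexN ℓ n j - 1) *
      hrCoeffBdHi a b ℓ n j
  else (b - ℓ - 1) * ratioSqProdHi ((a + ℓ) / 2) ((b + ℓ) / 2) c₁ c₂ (doIndexM ℓ n j) *
      hrCoeffBdHi a b ℓ n j

/-- **The enclosure down to the bound.** For `ℓ ≥ 1`, `ℓ + 1 ≤ a ≤ Δ ≤ b`, `Δ > ℓ + 1`,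
`c₁ ≤ c ≤ c₂` and all `n, j`:
`0 ≤ hrCoeffABBdLo ≤ (Δ-ℓ-1)·A_{n,j}(c,c;Δ,ℓ) ≤ hrCoeffABBdHi`.
[cite: DolanOsborn2004, §3 eq. (3.11)] [cite: HogervorstRychkov2013, §3 eq. (3.9)] -/
theorem sub_mul_hrCoeffAB_self_sandwich {c₁ c c₂ a Δ b : ℝ} {ℓ : ℕ} (hℓ : 1 ≤ ℓ)
    (ha : (ℓ : ℝ) + 1 ≤ a) (h1 : a ≤ Δ) (h2 : Δ ≤ b) (hx : (ℓ : ℝ) + 1 < Δ) (hc1 : c₁ ≤ c)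
    (hc2 : c ≤ c₂) (n j : ℕ) :
    0 ≤ hrCoeffABBdLo c₁ c₂ a b ℓ n j ∧
      hrCoeffABBdLo c₁ c₂ a b ℓ n j ≤ (Δ - ℓ - 1) * hrCoeffAB c c Δ ℓ n j ∧
      (Δ - ℓ - 1) * hrCoeffAB c c Δ ℓ n j ≤ hrCoeffABBdHi c₁ c₂ a b ℓ n j := by
  have hℓ1 : (1 : ℝ) ≤ ℓ := by exact_mod_cast hℓ
  obtain ⟨hB0, hBl, hBh⟩ := hrCoeffBd_mem_Icc hℓ ha h1 h2 hx n j
  -- the `m`-product: `X = (Δ+ℓ)/2 ∈ [(a+ℓ)/2, (b+ℓ)/2]`, `(a+ℓ)/2 > 0`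
  obtain ⟨hM0, hMl, hMh⟩ := ratioSqProd_sandwich (ylo := (a + ℓ) / 2) (y₀ := (Δ + ℓ) / 2)
    (yhi := (b + ℓ) / 2) (c₁ := c₁) (c := c) (c₂ := c₂) (by linarith) (by linarith) (by linarith)
    hc1 hc2 (doIndexM ℓ n j)
  by_cases h : j + 2 ≤ ℓ + n
  · rw [sub_mul_hrCoeffAB_self_eq_of_le hx h]
    unfold hrCoeffABBdLo hrCoeffABBdHi
    rw [if_pos h, if_pos h]
    -- the lead factor `4(x+c)²`
    have hS0 : 0 ≤ 4 * sqLower ((a - ℓ - 1) / 2 + c₁) ((b - ℓ - 1) / 2 + c₂) :=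
      mul_nonneg (by norm_num) (sqLower_nonneg _ _)
    have hSl : 4 * sqLower ((a - ℓ - 1) / 2 + c₁) ((b - ℓ - 1) / 2 + c₂) ≤
        4 * ((Δ - ℓ - 1) / 2 + c) ^ 2 :=
      mul_le_mul_of_nonneg_left (sqLower_le_sq (by linarith) (by linarith)) (by norm_num)
    have hSh : 4 * ((Δ - ℓ - 1) / 2 + c) ^ 2 ≤
        4 * sqUpper ((a - ℓ - 1) / 2 + c₁) ((b - ℓ - 1) / 2 + c₂) :=
      mul_le_mul_of_nonneg_left (sq_le_sqUpper (by linarith) (by linarith)) (by norm_num)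
    -- the shifted `n'`-product: `x + 1 ∈ [(a-ℓ-1)/2 + 1, (b-ℓ-1)/2 + 1]`, lower end `≥ 1`
    obtain ⟨hN0, hNl, hNh⟩ := ratioSqProd_sandwich (ylo := (a - ℓ - 1) / 2 + 1)
      (y₀ := (Δ - ℓ - 1) / 2 + 1) (yhi := (b - ℓ - 1) / 2 + 1) (c₁ := c₁) (c := c) (c₂ := c₂)
      (by linarith) (by linarith) (by linarith) hc1 hc2 (doIndexN ℓ n j - 1)
    obtain ⟨e0, el, eh⟩ := mul_sandwich hS0 hSl hSh hM0 hMl hMh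
    obtain ⟨f0, fl, fh⟩ := mul_sandwich e0 el eh hN0 hNl hNh
    exact mul_sandwich f0 fl fh hB0 hBl hBh
  · rw [sub_mul_hrCoeffAB_self_eq_of_not_le hx h]
    unfold hrCoeffABBdLo hrCoeffABBdHi
    rw [if_neg h, if_neg h]
    obtain ⟨e0, el, eh⟩ := mul_sandwich (show (0 : ℝ) ≤ a - ℓ - 1 by linarith)
      (show a - ℓ - 1 ≤ Δ - ℓ - 1 by linarith) (show Δ - ℓ - 1 ≤ b - ℓ - 1 by linarith) hM0 hMl hMh
    exact mul_sandwich e0 el eh hB0 hBl hBh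

/-- In particular `(Δ-ℓ-1)·A_{n,j}(c,c) ≥ 0` there. [cite: DolanOsborn2004, §3 eq. (3.11)] -/
theorem sub_mul_hrCoeffAB_self_nonneg {c Δ : ℝ} {ℓ : ℕ} (hℓ : 1 ≤ ℓ) (hx : (ℓ : ℝ) + 1 < Δ)
    (n j : ℕ) : 0 ≤ (Δ - ℓ - 1) * hrCoeffAB c c Δ ℓ n j := by
  obtain ⟨h0, hl, _⟩ := sub_mul_hrCoeffAB_self_sandwich (c₁ := c) (c₂ := c) (a := Δ) (b := Δ) hℓ
    hx.le le_rfl le_rfl hx le_rfl le_rfl n j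
  exact h0.trans hl

end Literature.MathematicalPhysics.QuantumFieldTheory.ConformalBootstrap3D
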